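import Summits.Ventures.HSemireg.WedgeHankelSubstitutionEigen

/-!
# Venture HSemireg — THE GENERAL LINEAR SUBSTITUTION (2e): A SUBSTITUTION WITH TWO FIXED NODES IS DIAGONALIZABLE ON THE CLASS SPACE — in the frame `{x + λ₁y, x + λ₂y}` of its fixed
# nodes it is the diagonal torus `(α+λ₁γ, α+λ₂γ)`, so the `n + 1` classes of that frame are an EIGENBASIS of `coSiegel_n` with the weights `(α+λ₁γ)^{n−p}(α+λ₂γ)^p` of `Sym^n`

HONEST FRAMING. Part of the Lean index of the computation cell `pub-hsemireg` (seat p10 gen 19, Sunday typer «UNIFORM-IN-n»).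
Finite-dimensional EXTERIOR ALGEBRA over a field + th-7's sequence vocabulary ONLY: no variety, no cohomology theory, no sheaf, no Ext group, no semiregularity map;
nothing here says that HC / HC_CM / HC_AV holds; no Literature fact is declared or used.  Custodian versions as in `WedgeHankelSiegelIdeal` (1/3) and `WedgeHankelFrameChange`;
the dictionary (the class space `coSiegel_n` = th-7's classes `w_n(q)` = `Sym^n` of the letters' `K²` under `GL₂`; a change of complex frame) is QUOTED, never asserted.

WHAT IS IN THE TREE.  H1 (899) `Sb`, `Sb_comp` (words are matrix products), `Sb_w`; H1b (909) `SbE` (det `≠ 0`); F9 `coSiegel_n_eq_span_w`, `linearIndependent_w_spike`, `finrank_coSiegel_n`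
(`= n + 1`), `w_mem_coSiegel`; I4 `WedgeHankelSubstitutionEigen` (this seat, 945): `Sb_diag_w_spike` (th-7's `E_p` are the weight vectors of the diagonal torus, weights `a^{m−p}d^p`),
`mobius_fixed_two_iff` (two fixed nodes ⇔ the torus `δ = α + (λ₁+λ₂)γ`, `β = −λ₁λ₂γ`), `Sb_w_pure_of_fixed` (the two pure classes are eigenvectors).  I4's header left «the full eigenspace
decomposition of `Sb g` on `coSiegel_n` for a diagonalizable `g`» as NOT typed.  THIS FILE types it (namespace `Summit.Ventures.HSemireg.Wedge.HankelFrameChange` continued):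
* §177 **`Sb_comp_frame_of_fixed`: `β + λ_iδ = λ_i(α + λ_iγ)` (`i = 1, 2`) ⇒ `Sb α β γ δ ∘ Sb 1 λ₁ 1 λ₂ = Sb 1 λ₁ 1 λ₂ ∘ Sb (α+λ₁γ) 0 0 (α+λ₂γ)`** — in the frame `x ↦ x + λ₁y`, `y ↦ x + λ₂y`
  of its two fixed nodes the substitution IS the diagonal torus (`Sb_comp` twice; no `λ₁ ≠ λ₂` needed for the identity itself); `Sb_Sb_frame_of_fixed` (applied);
  the node `∞`: **`Sb_comp_frame_of_fixed_infty`** (`γ = 0`, `β + λ₁δ = λ₁α` ⇒ `Sb α β 0 δ ∘ Φs-frame Sb 1 λ₁ 0 1 = Sb 1 λ₁ 0 1 ∘ Sb α 0 0 δ`).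
* §178 THE EIGENBASIS: **`Sb_frame_spike_eigen`: `Sb α β γ δ (F_p) = (α+λ₁γ)^{m−p}(α+λ₂γ)^p · F_p`** for the frame classes `F_p := Sb 1 λ₁ 1 λ₂ (E_p)`, `E_p = w_m(δ_p)`, `m ≤ n`
  (I4 `Sb_diag_w_spike` transported); `Sb_frame_spike_eigen_infty` (`F_p := Sb 1 λ₁ 0 1 (E_p)`, eigenvalues `α^{m−p}δ^p`); `frame_spike_mem_coSiegel`.
* §179 for `λ₁ ≠ λ₂` the frame change is invertible (`det = λ₂ − λ₁`): **`linearIndependent_frame_spike`** (the `n + 1` frame classes are independent — F9's spike basis through `SbE`),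
  **`span_frame_spike_eq_coSiegel`** (they span the class space `coSiegel_n`, `finrank = n + 1`): A SUBSTITUTION WITH TWO DISTINCT FINITE FIXED NODES IS DIAGONALIZABLE ON THE CLASS SPACE
  WITH THE EIGENVALUES `(α+λ₁γ)^{n−p}(α+λ₂γ)^p`, `p = 0, …, n` (the weights of `Sym^n`, dictionary quoted); the `∞` companion `linearIndependent_frame_spike_infty` /
  `span_frame_spike_infty_eq_coSiegel` (always invertible, `det = 1`).
NOT typed here: the parabolic case (ONE fixed node, a Jordan block of size `n + 1` in characteristic `0` or `> n`); the determinant / trace of `Sb g` on `coSiegel_n` as a `LinearMap.det` of the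
restriction (`= (det g)^{n(n+1)/2}`, cf. I1 `det_sbMat`); fixed nodes outside `K` (irreducible characteristic polynomial); anything Ext-side.  Class side only; new names only.
-/

open Module

namespace Summit.Ventures.HSemireg.Wedge.HankelFrameChange

open Summit.Ventures.HSemireg.Wedge Summit.Ventures.HSemireg.Wedge.Kunneth Summit.Ventures.HSemireg.Wedge.Hankel
  Summit.Ventures.HSemireg.Wedge.BasisFree Summit.Ventures.HSemireg.Wedge.HankelSiegel Summit.Ventures.HSemireg.Wedge.HankelSiegelIdeal
  Summit.Ventures.HSemireg.Wedge.KunnethKernel Summit.Ventures.HSemireg.Wedge.HankelRankOne Summit.Ventures.HSemireg.Wedge.KernelDuality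

variable (K : Type*) [Field K] {n : ℕ}

/-! ## §177. In the frame of its fixed nodes a substitution is the diagonal torus -/

/-- **`β + λ_iδ = λ_i(α + λ_iγ)` for `i = 1, 2` ⇒ `Sb α β γ δ ∘ Sb 1 λ₁ 1 λ₂ = Sb 1 λ₁ 1 λ₂ ∘ Sb (α+λ₁γ) 0 0 (α+λ₂γ)`** — the frame change `x ↦ x + λ₁y`, `y ↦ x + λ₂y` conjugates the
substitution to the DIAGONAL torus of its two eigenvalues on the letters (`Sb_comp`: words are matrix products). -/
theorem Sb_comp_frame_of_fixed {α β γ δ l₁ l₂ : K} (e₁ : β + l₁ * δ = l₁ * (α + l₁ * γ)) (e₂ : β + l₂ * δ = l₂ * (α + l₂ * γ)) :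
    (Sb K α β γ δ).comp (Sb K (n := n) 1 l₁ 1 l₂) = (Sb K 1 l₁ 1 l₂).comp (Sb K (n := n) (α + l₁ * γ) 0 0 (α + l₂ * γ)) := by
  rw [Sb_comp, Sb_comp]
  congr 1
  · ring
  · linear_combination e₁
  · ring
  · linear_combination e₂

/-- applied form. -/
theorem Sb_Sb_frame_of_fixed {α β γ δ l₁ l₂ : K} (e₁ : β + l₁ * δ = l₁ * (α + l₁ * γ)) (e₂ : β + l₂ * δ = l₂ * (α + l₂ * γ)) (f : HT K (In n)) :
    Sb K α β γ δ (Sb K 1 l₁ 1 l₂ f) = Sb K 1 l₁ 1 l₂ (Sb K (α + l₁ * γ) 0 0 (α + l₂ * γ) f) := by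
  rw [← AlgHom.comp_apply, Sb_comp_frame_of_fixed K e₁ e₂, AlgHom.comp_apply]

/-- **the node `∞` among the two: `γ = 0`, `β + λ₁δ = λ₁α` ⇒ `Sb α β 0 δ ∘ Sb 1 λ₁ 0 1 = Sb 1 λ₁ 0 1 ∘ Sb α 0 0 δ`** (frame `{x + λ₁y, y}`; eigenvalues `α` on `x + λ₁y`, `δ` on `y`). -/
theorem Sb_comp_frame_of_fixed_infty {α β δ l₁ : K} (e₁ : β + l₁ * δ = l₁ * α) :
    (Sb K α β 0 δ).comp (Sb K (n := n) 1 l₁ 0 1) = (Sb K 1 l₁ 0 1).comp (Sb K (n := n) α 0 0 δ) := by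
  rw [Sb_comp, Sb_comp]
  congr 1
  · ring
  · linear_combination e₁
  · ring
  · ring

/-- applied form at `∞`. -/
theorem Sb_Sb_frame_of_fixed_infty {α β δ l₁ : K} (e₁ : β + l₁ * δ = l₁ * α) (f : HT K (In n)) :
    Sb K α β 0 δ (Sb K 1 l₁ 0 1 f) = Sb K 1 l₁ 0 1 (Sb K α 0 0 δ f) := by
  rw [← AlgHom.comp_apply, Sb_comp_frame_of_fixed_infty K e₁, AlgHom.comp_apply]

/-! ## §178. The frame classes are eigenvectors -/

/-- **THE FRAME CLASSES ARE EIGENVECTORS: `Sb α β γ δ (F_p) = (α+λ₁γ)^{m−p}(α+λ₂γ)^p · F_p`, `F_p := Sb 1 λ₁ 1 λ₂ (w_m(δ_p))`** (`m ≤ n`; the weights of `Sym^m`). -/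
theorem Sb_frame_spike_eigen {α β γ δ l₁ l₂ : K} (e₁ : β + l₁ * δ = l₁ * (α + l₁ * γ)) (e₂ : β + l₂ * δ = l₂ * (α + l₂ * γ)) {m : ℕ} (p : ℕ) (hm : m ≤ n) :
    Sb K α β γ δ (Sb K 1 l₁ 1 l₂ (w K n m (fun j => if j = p then (1 : K) else 0))) =
      ((α + l₁ * γ) ^ (m - p) * (α + l₂ * γ) ^ p) • Sb K 1 l₁ 1 l₂ (w K n m (fun j => if j = p then (1 : K) else 0)) := by
  rw [Sb_Sb_frame_of_fixed K e₁ e₂, Sb_diag_w_spike K _ _ p hm, map_smul]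

/-- the `∞` companion: `Sb α β 0 δ (Sb 1 λ₁ 0 1 (E_p)) = α^{m−p}δ^p · Sb 1 λ₁ 0 1 (E_p)`. -/
theorem Sb_frame_spike_eigen_infty {α β δ l₁ : K} (e₁ : β + l₁ * δ = l₁ * α) {m : ℕ} (p : ℕ) (hm : m ≤ n) :
    Sb K α β 0 δ (Sb K 1 l₁ 0 1 (w K n m (fun j => if j = p then (1 : K) else 0))) =
      (α ^ (m - p) * δ ^ p) • Sb K 1 l₁ 0 1 (w K n m (fun j => if j = p then (1 : K) else 0)) := by
  rw [Sb_Sb_frame_of_fixed_infty K e₁, Sb_diag_w_spike K _ _ p hm, map_smul]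

/-- the frame classes lie in the class space: `Sb α′ β′ γ′ δ′ (w_n(q)) ∈ coSiegel_n` (every substitution; `Sb_w`). -/
theorem Sb_w_mem_coSiegel (α' β' γ' δ' : K) (q : ℕ → K) : Sb K α' β' γ' δ' (w K n n q) ∈ coSiegel K n n := by
  rw [Sb_w K α' β' γ' δ' le_rfl]
  exact w_mem_coSiegel K _

/-! ## §179. The eigenbasis of the class space -/

/-- the frame classes of an INVERTIBLE frame change are linearly independent (F9's spike basis through `SbE`). -/
theorem linearIndependent_Sb_w_spike {α' β' γ' δ' : K} (h : α' * δ' - β' * γ' ≠ 0) :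
    LinearIndependent K (fun p : Fin (n + 1) => Sb K α' β' γ' δ' (w K n n (fun j => if j = (p : ℕ) then (1 : K) else 0))) := by
  have e : (fun p : Fin (n + 1) => Sb K α' β' γ' δ' (w K n n (fun j => if j = (p : ℕ) then (1 : K) else 0))) =
      (SbE K (n := n) h).toLinearEquiv.toLinearMap ∘ (fun p : Fin (n + 1) => w K n n (fun j => if j = (p : ℕ) then (1 : K) else 0)) := by
    funext p; rfl
  rw [e]
  exact (linearIndependent_w_spike K).map' _ (LinearEquiv.ker _)

/-- … and they span the class space `coSiegel_n` (`finrank = n + 1`). -/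
theorem span_Sb_w_spike_eq_coSiegel {α' β' γ' δ' : K} (h : α' * δ' - β' * γ' ≠ 0) :
    Submodule.span K (Set.range fun p : Fin (n + 1) => Sb K α' β' γ' δ' (w K n n (fun j => if j = (p : ℕ) then (1 : K) else 0))) = coSiegel K n n := by
  refine Submodule.eq_of_le_of_finrank_eq ?_ ?_
  · rw [Submodule.span_le]
    rintro _ ⟨p, rfl⟩
    exact Sb_w_mem_coSiegel K _ _ _ _ _
  · rw [finrank_span_eq_card (linearIndependent_Sb_w_spike K h), Fintype.card_fin, finrank_coSiegel_n]

/-- **A SUBSTITUTION WITH TWO DISTINCT FINITE FIXED NODES `λ₁ ≠ λ₂` IS DIAGONALIZABLE ON THE CLASS SPACE**: the `n + 1` frame classes `F_p = Sb 1 λ₁ 1 λ₂ (E_p)` are linearly independent … -/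
theorem linearIndependent_frame_spike {l₁ l₂ : K} (h₁₂ : l₁ ≠ l₂) :
    LinearIndependent K (fun p : Fin (n + 1) => Sb K 1 l₁ 1 l₂ (w K n n (fun j => if j = (p : ℕ) then (1 : K) else 0))) :=
  linearIndependent_Sb_w_spike K (by rw [one_mul, mul_one]; exact sub_ne_zero.mpr (Ne.symm h₁₂))

/-- **… they span `coSiegel_n` …** -/
theorem span_frame_spike_eq_coSiegel {l₁ l₂ : K} (h₁₂ : l₁ ≠ l₂) :
    Submodule.span K (Set.range fun p : Fin (n + 1) => Sb K 1 l₁ 1 l₂ (w K n n (fun j => if j = (p : ℕ) then (1 : K) else 0))) = coSiegel K n n :=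
  span_Sb_w_spike_eq_coSiegel K (by rw [one_mul, mul_one]; exact sub_ne_zero.mpr (Ne.symm h₁₂))

/-- **… and each is an eigenvector of every substitution fixing the two nodes, with eigenvalue `(α+λ₁γ)^{n−p}(α+λ₂γ)^p`** (`p : Fin (n+1)`; the torus of I4 `mobius_fixed_two_iff`). -/
theorem Sb_frame_spike_eigen_top {α β γ δ l₁ l₂ : K} (e₁ : β + l₁ * δ = l₁ * (α + l₁ * γ)) (e₂ : β + l₂ * δ = l₂ * (α + l₂ * γ)) (p : Fin (n + 1)) :
    Sb K α β γ δ (Sb K 1 l₁ 1 l₂ (w K n n (fun j => if j = (p : ℕ) then (1 : K) else 0))) =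
      ((α + l₁ * γ) ^ (n - (p : ℕ)) * (α + l₂ * γ) ^ (p : ℕ)) • Sb K 1 l₁ 1 l₂ (w K n n (fun j => if j = (p : ℕ) then (1 : K) else 0)) :=
  Sb_frame_spike_eigen K e₁ e₂ p le_rfl

/-- the `∞` companion: the classes `Sb 1 λ₁ 0 1 (E_p)` (`= Φs λ₁ (E_p)`, the classes of the frame `{x + λ₁y, y}`) are linearly independent … -/
theorem linearIndependent_frame_spike_infty (l₁ : K) :
    LinearIndependent K (fun p : Fin (n + 1) => Sb K 1 l₁ 0 1 (w K n n (fun j => if j = (p : ℕ) then (1 : K) else 0))) :=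
  linearIndependent_Sb_w_spike K (by rw [one_mul, mul_zero, sub_zero]; exact one_ne_zero)

/-- … span `coSiegel_n` … -/
theorem span_frame_spike_infty_eq_coSiegel (l₁ : K) :
    Submodule.span K (Set.range fun p : Fin (n + 1) => Sb K 1 l₁ 0 1 (w K n n (fun j => if j = (p : ℕ) then (1 : K) else 0))) = coSiegel K n n :=
  span_Sb_w_spike_eq_coSiegel K (by rw [one_mul, mul_zero, sub_zero]; exact one_ne_zero)

/-- … and are eigenvectors of every UPPER substitution fixing `λ₁` (`γ = 0`, `β + λ₁δ = λ₁α`), eigenvalues `α^{n−p}δ^p`. -/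
theorem Sb_frame_spike_eigen_infty_top {α β δ l₁ : K} (e₁ : β + l₁ * δ = l₁ * α) (p : Fin (n + 1)) :
    Sb K α β 0 δ (Sb K 1 l₁ 0 1 (w K n n (fun j => if j = (p : ℕ) then (1 : K) else 0))) =
      (α ^ (n - (p : ℕ)) * δ ^ (p : ℕ)) • Sb K 1 l₁ 0 1 (w K n n (fun j => if j = (p : ℕ) then (1 : K) else 0)) :=
  Sb_frame_spike_eigen_infty K e₁ p le_rfl

end Summit.Ventures.HSemireg.Wedge.HankelFrameChange
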